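import Summits.AnomalousDissipation.AnomalousDissipation.Theorems.MomentParityGalerkinLiouvilleTest
import Summits.AnomalousDissipation.AnomalousDissipation.Theorems.MomentParityMomentClosure
import Summits.AnomalousDissipation.AnomalousDissipation.Theorems.QuarticGate.Negative.LevelCeiling
import Literature.Analysis.FluidPDE.GalerkinInvariantMeasure

/-!
# `MomentParity.ResolvedDissipation` (stmt-AnomalousDissipation-14284), line `enstrophy-ui-transfer`:
# ADMISSIBLE LAWS ARE INVARIANT under the Galerkin semiflow (coefficient picture)

Supports stmt-AnomalousDissipation-14284 (helper of the line lead; nothing here closes an item).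

The admissible laws of the crux — probability laws on `H` carried by level-`N` fields, supported in a ball, stationary
for Galerkin NS at `(ν, f)` against all POLYNOMIAL cylindrical band-limited observables — are exactly what the
stationary-row (identity) attacks on the hard stub `stub_uniformIntegrability` use. Every DYNAMICAL attack (the line
card's U1 maximal ergodic function, U2 excursion/duration census, Birkhoff averages) needs more: invariance of the law
under the Galerkin flow. This file supplies it by gluing three landed pieces:
(1) polynomial rows ⇒ rows for every `C¹` compactly supported cylindrical functional with band-limited fields
    (`MomentParityMomentClosure.integral_nsGeneratorPairing_grad_eq_zero`, Weierstrass-`C¹` on the compact carrier);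
(2) such rows ⇒ the stationary Liouville equation of the level-`N` Galerkin ODE for the law of the coefficient vector
    `Θ u = û|_{freqBall N}` (`MomentParity.integral_fderiv_galerkinRHS_comp_eq_zero`);
(3) Liouville ⇒ invariance under the Galerkin semiflow (`Literature.Analysis.FluidPDE.map_galerkinCoeffFlow_eq_self`).

* `admissible_rows_cylindrical` — step (1) packaged;
* `admissible_coeffLaw_liouville` — step (2) on the coefficient space (via `integral_map`);
* `admissible_coeffLaw_invariant` — the coefficient law `μ.map Θ` is invariant under `galerkinCoeffFlow ν f̂|_S t`, `t ≥ 0`.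
-/

noncomputable section

-- `Summit.<Summit>.<Problem>`: single-conjunct summit, the duplicate namespace segment is mandated.
set_option linter.dupNamespace false

namespace Summit.AnomalousDissipation.AnomalousDissipation.Theorems.MomentParityResolvedDissipation

open MeasureTheory Filter Topology Set Function
open scoped ENNReal InnerProductSpace RealInnerProductSpace
open Literature.Analysis.FunctionSpaces Literature.Analysis.FunctionSpaces.Torus
open Literature.Analysis.FluidPDE Literature.Analysis.FluidPDE.Torus
open Summit.AnomalousDissipation.AnomalousDissipation.Theses.MomentParity
open Summit.AnomalousDissipation.AnomalousDissipation.Theorems.CubicParityLoud.Negative (T3 R3 H3 L2T3)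
open Summit.AnomalousDissipation.AnomalousDissipation.Theorems.QuarticGate.Negative
  (IsLevel IsBandTest polyGrad IsPolyStationary)

/-- **Admissible laws annihilate the generator on every band-limited cylindrical test** (integrable row, zero
mean): the all-degree polynomial stationarity of the crux upgrades, on the compact level ball, to every `C¹`
compactly supported profile (`MomentParityMomentClosure.integral_nsGeneratorPairing_grad_eq_zero`). [folklore] -/
theorem admissible_rows_cylindrical {ν : ℝ} {f : T3 → R3} (hf : Torus.IsSmooth f) {N : ℕ} {R : ℝ}
    {μ : Measure H3} [IsProbabilityMeasure μ] (hL : ∀ᵐ u ∂μ, IsLevel N u) (hB : ∀ᵐ u ∂μ, ‖u‖ ≤ R)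
    (hS : ∀ d : ℕ, IsPolyStationary ν f N d μ) (Φ : CylindricalTest (Fin 3))
    (hΦ : ∀ i, ∀ k ∉ (freqBall N).erase (0 : Fin 3 → ℤ),
      UnitAddTorus.mFourierCoeff (EuclideanSpace.complexify ∘ Φ.g i) k = 0) :
    Integrable (fun u => nsGeneratorPairing ν f u (Φ.grad u)) μ ∧
      ∫ u, nsGeneratorPairing ν f u (Φ.grad u) ∂μ = 0 := by
  have hfi : Integrable f volume := hf.integrable
  -- the support radius is nonnegative
  haveI : (ae μ).NeBot := ae_neBot.2 (IsProbabilityMeasure.ne_zero μ)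
  obtain ⟨u₀, hu₀⟩ := hB.exists
  have hR : 0 ≤ R := (norm_nonneg _).trans hu₀
  have hμK : ∀ᵐ u ∂μ, u ∈ {u : H3 | CubicParityLoud.Negative.IsLevel N u ∧ ‖u‖ ≤ R} :=
    (hL.and hB).mono fun u hu => hu
  have hK := MomentParityMomentClosure.isCompact_levelBall N hR
  refine ⟨MomentParityMomentClosure.integrable_of_continuous_of_ae_mem hK hμK
      (Torus.continuous_nsGeneratorPairing_grad ν hfi Φ),
    MomentParityMomentClosure.integral_nsGeneratorPairing_grad_eq_zero ν hfi hR hμK Φ fun P => ?_⟩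
  have hband : ∀ i, IsBandTest N (Φ.g i) := fun i =>
    ⟨Φ.g_smooth i, Φ.g_divFree i, Φ.g_zeroMean i, hΦ i⟩
  exact (hS (P.totalDegree + 1) Φ.m Φ.g P hband le_rfl).2

/-- **The coefficient law of an admissible law satisfies the stationary Liouville equation of the Galerkin ODE.**
With `Θ u = û|_{freqBall N}` and a mean-zero smooth force, for every `C¹` function `ψ` on the coefficient space
`∫ Dψ(c)[galerkinRHS(f̂|_S, c)] d(Θ_* μ)(c) = 0`. [folklore] -/
theorem admissible_coeffLaw_liouville {ν : ℝ} {f : T3 → R3} (hf : Torus.IsSmooth f) (hf0 : Torus.HasZeroMean f)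
    {N : ℕ} {R : ℝ} {μ : Measure H3} [IsProbabilityMeasure μ] (hL : ∀ᵐ u ∂μ, IsLevel N u) (hB : ∀ᵐ u ∂μ, ‖u‖ ≤ R)
    (hS : ∀ d : ℕ, IsPolyStationary ν f N d μ)
    {ψ : (↥(freqBall (d := Fin 3) N) → EuclideanSpace ℂ (Fin 3)) → ℝ} (hψ : ContDiff ℝ 1 ψ) :
    ∫ c, fderiv ℝ ψ c (galerkinRHS (freqBall N) ν (fourierRestrict (freqBall N) f) c)
        ∂(μ.map fun u : H3 => fourierRestrict (freqBall N) (u.1 : T3 → R3)) = 0 := by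
  have hΘ : Continuous fun u : H3 => fourierRestrict (freqBall N) (u.1 : T3 → R3) :=
    continuous_pi fun k => (Torus.continuous_mFourierCoeff_complexify_coe (k : Fin 3 → ℤ)).comp
      continuous_subtype_val
  have hint : Continuous fun c : ↥(freqBall (d := Fin 3) N) → EuclideanSpace ℂ (Fin 3) =>
      fderiv ℝ ψ c (galerkinRHS (freqBall N) ν (fourierRestrict (freqBall N) f) c) :=
    (hψ.continuous_fderiv one_ne_zero).clm_apply (contDiff_galerkinRHS ν _ (n := 1)).continuous
  rw [integral_map hΘ.aemeasurable hint.aestronglyMeasurable]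
  exact (MomentParity.integral_fderiv_galerkinRHS_comp_eq_zero ν (hf.memLp 2) hf0 hL hB
    (fun Φ hΦ => admissible_rows_cylindrical hf hL hB hS Φ hΦ) hψ).2

/-- **ADMISSIBLE LAWS ARE INVARIANT UNDER THE GALERKIN SEMIFLOW (coefficient picture).** Let `ν ≥ 0`-viscosity
Galerkin NS at level `N` be driven by a smooth mean-zero force `f`, and let `μ` be an admissible law of the crux at
`(ν, f, N, R)`: a probability law on `H` carried by level-`N` fields, supported in `‖u‖ ≤ R`, stationary against all
polynomial cylindrical band-limited observables (`0 < ν`). Then the law `Θ_* μ` of the coefficient vector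
`Θ u = û|_{freqBall N}` is invariant under the Galerkin semiflow: `(galerkinCoeffFlow ν f̂|_S t)_* (Θ_* μ) = Θ_* μ`
for every `t ≥ 0` (Foias–Manley–Rosa–Temam 2001 Ch. IV App. B.1: Liouville ⟹ invariant, through the landed
`map_galerkinCoeffFlow_eq_self`; compact carrier = image of the level ball). This is the entry point of every
DYNAMICAL attack (Birkhoff averages, maximal ergodic function, excursion census) on the hard stub
`stub_uniformIntegrability`. [cite: FMRT2001, Ch. IV App. B.1 pp. 247–249] -/
theorem admissible_coeffLaw_invariant :
    ∀ (ν : ℝ), 0 < ν → ∀ (f : T3 → R3), Torus.IsSmooth f → Torus.HasZeroMean f →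
    ∀ (N : ℕ) (R : ℝ) (μ : Measure H3), IsProbabilityMeasure μ →
      (∀ᵐ u ∂μ, IsLevel N u) → (∀ᵐ u ∂μ, ‖u‖ ≤ R) → (∀ d : ℕ, IsPolyStationary ν f N d μ) →
    ∀ t : ℝ, 0 ≤ t →
      (μ.map fun u : H3 => fourierRestrict (freqBall N) (u.1 : T3 → R3)).map
          (galerkinCoeffFlow ν (fourierRestrict (freqBall N) f) t) =
        μ.map fun u : H3 => fourierRestrict (freqBall N) (u.1 : T3 → R3) := by
  intro ν hν f hf hf0 N R μ hP hL hB hS t ht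
  have hSsym : ∀ k ∈ freqBall (d := Fin 3) N, -k ∈ freqBall (d := Fin 3) N := neg_mem_freqBall_of_mem
  have hg : IsRealCoeff (fourierRestrict (freqBall (d := Fin 3) N) f) := isRealCoeff_mFourierCoeff hf.integrable
  have hΘ : Continuous fun u : H3 => fourierRestrict (freqBall N) (u.1 : T3 → R3) :=
    continuous_pi fun k => (Torus.continuous_mFourierCoeff_complexify_coe (k : Fin 3 → ℤ)).comp
      continuous_subtype_val
  -- nonnegative radius and the compact carrier of the coefficient law
  haveI : (ae μ).NeBot := ae_neBot.2 (IsProbabilityMeasure.ne_zero μ)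
  obtain ⟨u₀, hu₀⟩ := hB.exists
  have hR : 0 ≤ R := (norm_nonneg _).trans hu₀
  set Kball : Set H3 := {u : H3 | CubicParityLoud.Negative.IsLevel N u ∧ ‖u‖ ≤ R} with hKball
  have hKc : IsCompact Kball := MomentParityMomentClosure.isCompact_levelBall N hR
  set K : Set (↥(freqBall (d := Fin 3) N) → EuclideanSpace ℂ (Fin 3)) :=
    (fun u : H3 => fourierRestrict (freqBall N) (u.1 : T3 → R3)) '' Kball with hK
  have hK : IsCompact K := hKc.image hΘ
  have hKV : K ⊆ (galerkinSubspace (freqBall (d := Fin 3) N) : Set _) := by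
    rintro _ ⟨u, -, rfl⟩
    exact MomentParity.fourierRestrict_coe_mem_galerkinSubspace N u
  haveI : IsFiniteMeasure (μ.map fun u : H3 => fourierRestrict (freqBall N) (u.1 : T3 → R3)) :=
    Measure.isFiniteMeasure_map μ _
  have hμK : (μ.map fun u : H3 => fourierRestrict (freqBall N) (u.1 : T3 → R3)) Kᶜ = 0 := by
    rw [Measure.map_apply hΘ.measurable hK.isClosed.measurableSet.compl, measure_eq_zero_iff_ae_notMem]
    filter_upwards [hL, hB] with u hu1 hu2
    intro h
    exact h ⟨u, ⟨hu1, hu2⟩, rfl⟩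
  exact map_galerkinCoeffFlow_eq_self hν.le hSsym hg hK hKV hμK
    (fun ψ hψ _ => admissible_coeffLaw_liouville hf hf0 hL hB hS hψ) t ht

end Summit.AnomalousDissipation.AnomalousDissipation.Theorems.MomentParityResolvedDissipation

end
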